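import Summits.AnomalousDissipation.AnomalousDissipation.Theses.TwoAndHalfD
import Literature.Analysis.FluidPDE.TwoHalfNavierStokes
import Literature.Analysis.FluidPDE.PassiveScalarForced
import Literature.Analysis.FluidPDE.PassiveScalarForcedClass
import Literature.Analysis.FluidPDE.SourcedScalarBudget
import Literature.Analysis.FunctionSpaces.TorusCalculusProofs
import Literature.Barriers.AnomalousDissipation.SingleShellEnstrophyBoundMean
import Summits.AnomalousDissipation.AnomalousDissipation.Theorems.TwoAndHalfDTwohalfdNegQuietOfSubLog

/-!
# Bounded co-scalar variance forces bounded enstrophy  (stub stub_coscalarEnstrophyBound of the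
# line `log-kantorovich-enstrophy-transfer`, crux `TwoAndHalfD.TwohalfdNeg`, stmt-AnomalousDissipation-0211)

For `ν > 0`, `c ≠ 0`, a smooth steady planar field `g`, a global two-dimensional Leray–Hopf
solution `v`, a weak SOURCED passive scalar `θ` with source `c · curl g` from `θ₀ ∈ L²`, a
mean-zero `ω₀ ∈ L²` and, on every horizon `[0,T)`, a weak sourced scalar `ω` with source
`curl g`, datum `ω₀`, the same drift `v`, carrying the enstrophy (`‖ω t‖₂² = ‖∇v(t)‖₂²` a.e.):
`⟨‖∇v‖₂²⟩ ≤ (2/c²) ⟨‖θ‖₂²⟩` (honest `limsup` long-time means).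

Proof. On `[0,T)` the combination `q := θ - c ω` is a weak solution of the FREE
advection–diffusion equation from `q₀ = θ₀ - c ω₀` (linearity of the distributional formulation,
`isWeakScalarTransportOn_sub_mul`); the DiPerna–Lions energy inequality over the `L¹ₜḢ¹ₓ`
Leray–Hopf drift (`IsWeakScalarTransportOn.energy_ineq_of_lintegral_eGradNormSq_rpow_lt_top`)
gives `2ν ∫₀ᵀ ‖∇q‖² ≤ ‖q₀‖²`; mean conservation for `ω` (`∫ curl g = 0`) and the spectral
Poincaré inequality give, for a.e. `t`,
`c²‖ω t‖² ≤ 2‖θ t‖² + 2 Var(q t) ≤ 2‖θ t‖² + ‖∇q t‖²/(2π²)` (`sq_mul_scalarL2Sq_le`), whence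
`∫₀ᵀ ‖∇v‖² ≤ (2/c²)∫₀ᵀ‖θ‖² + ‖q₀‖²/(4π²νc²)` for EVERY `T`
(`setIntegral_enstrophy_le`), and the integrated comparison passes to `limsup` running means
because those of `‖θ‖²` are honestly bounded (`Torus.isBoundedUnder_timeMean_scalarL2Sq`,
`Literature.Barriers.AnomalousDissipation.longTimeAvgSup_le_mul_of_setIntegral_le`).
References: DiPerna–Lions, Invent. Math. 98 (1989), §II.1–II.3; Doering–Foias, JFM 467 (2002), §2.
-/

namespace Summit.AnomalousDissipation.AnomalousDissipation.Theorems.TwohalfdNeg.CoscalarEnstrophyBound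

open MeasureTheory Filter Topology
open scoped ENNReal NNReal
open Literature.Analysis.FunctionSpaces Literature.Analysis.FluidPDE

-- `Summit.AnomalousDissipation.AnomalousDissipation.…` is the mandated summit-side namespace (CONVENTIONS §2).
set_option linter.dupNamespace false

open Set
open scoped InnerProductSpace

/-! ## Linearity of the sourced weak formulation -/

/-- **Linearity of the distributional formulation.** If `θ₁` is a weak solution of
`∂ₜθ + u·∇θ = κΔθ + s₁` from `a₁` and `θ₂` one of `∂ₜθ + u·∇θ = κΔθ + s₂` from `a₂` on `[0,T)`,
over the same drift, with `s₁ = c s₂` and integrable data, then `θ₁ - c θ₂` is a weak solution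
of the HOMOGENEOUS advection–diffusion equation from `a₁ - c a₂` (every conjunct of the class is
(sub)linear; the source pairings cancel) (DiPerna–Lions 1989, §II.1). [folklore] -/
theorem isWeakScalarTransportOn_sub_mul {d : Type*} [Fintype d] {T κ c : ℝ}
    {u : ℝ → UnitAddTorus d → EuclideanSpace ℝ d} {s₁ s₂ : ℝ → UnitAddTorus d → ℝ}
    {a₁ a₂ : UnitAddTorus d → ℝ} {θ₁ θ₂ : ℝ → UnitAddTorus d → ℝ}
    (h₁ : Torus.IsWeakScalarTransportForcedOn T κ u s₁ a₁ θ₁)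
    (h₂ : Torus.IsWeakScalarTransportForcedOn T κ u s₂ a₂ θ₂)
    (hs : ∀ t x, s₁ t x = c * s₂ t x) (ha₁ : Integrable a₁ volume) (ha₂ : Integrable a₂ volume) :
    Torus.IsWeakScalarTransportOn T κ u (fun x => a₁ x - c * a₂ x)
      (fun t x => θ₁ t x - c * θ₂ t x) where
  aestronglyMeasurable := h₁.aestronglyMeasurable.sub (h₂.aestronglyMeasurable.const_mul c)
  aestronglyMeasurable_velocity := h₁.aestronglyMeasurable_velocity
  ae_lintegral_sq_le := by
    obtain ⟨C₁, hC₁⟩ := h₁.exists_eLpNorm_le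
    obtain ⟨C₂, hC₂⟩ := h₂.exists_eLpNorm_le
    refine ⟨(C₁ + ‖c‖₊ * C₂) ^ 2, ?_⟩
    filter_upwards [hC₁, hC₂, h₁.ae_memLp_two, h₂.ae_memLp_two] with t hc₁ hc₂ hm₁ hm₂
    have hm₂' : MemLp (c • θ₂ t) 2 volume := hm₂.const_smul c
    have hsub : eLpNorm (θ₁ t - c • θ₂ t) 2 volume ≤ C₁ + ‖c‖₊ * C₂ := by
      refine (eLpNorm_sub_le hm₁.1 hm₂'.1 one_le_two).trans (add_le_add hc₁ ?_)
      rw [eLpNorm_const_smul]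
      exact mul_le_mul' le_rfl hc₂
    have e : ∫⁻ x, ‖θ₁ t x - c * θ₂ t x‖ₑ ^ 2 = eLpNorm (θ₁ t - c • θ₂ t) 2 volume ^ 2 := by
      rw [PassiveScalarProofs.eLpNorm_two_pow_two]
      rfl
    rw [e, ENNReal.coe_pow, ENNReal.coe_add, ENNReal.coe_mul]
    exact pow_le_pow_left' hsub 2
  lintegral_velocity_lt_top := h₁.lintegral_velocity_lt_top
  lintegral_mul_lt_top := by
    have hprod : Integrable
        (fun p : ℝ × UnitAddTorus d => ‖u p.1 p.2‖ * (θ₁ p.1 p.2 - c * θ₂ p.1 p.2))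
        (((volume : Measure ℝ).restrict (Ioo 0 T)).prod volume) :=
      (h₁.integrable_norm_velocity_mul.sub (h₂.integrable_norm_velocity_mul.const_mul c)).congr
        (Eventually.of_forall fun p => by simp only [Pi.sub_apply]; ring)
    have hfin := hprod.hasFiniteIntegral
    rw [hasFiniteIntegral_iff_enorm, lintegral_prod _ hprod.aestronglyMeasurable.enorm] at hfin
    refine lt_of_le_of_lt (lintegral_mono fun t => lintegral_mono fun x => ?_) hfin
    rw [← enorm_norm (u t x), ← enorm_mul]
  ae_isWeaklyDivFree := h₁.ae_isWeaklyDivFree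
  weak_eq ψ hψ := by
    have e₁ := h₁.weak_eq ψ hψ
    have e₂ := h₂.weak_eq ψ hψ
    have hI₁ := h₁.integrable_weakIntegrand hψ
    have hI₂ := h₂.integrable_weakIntegrand hψ
    -- the transport pairing, slice by slice
    have hslice : ∀ᵐ t ∂(volume.restrict (Ioo 0 T)),
        ∫ x, (θ₁ t x - c * θ₂ t x) * (Torus.timeDeriv ψ t x +
          ⟪u t x, Torus.gradient (ψ t) x⟫_ℝ + κ * Torus.laplacian (ψ t) x) =
        (∫ x, θ₁ t x * (Torus.timeDeriv ψ t x +
          ⟪u t x, Torus.gradient (ψ t) x⟫_ℝ + κ * Torus.laplacian (ψ t) x)) -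
        c * ∫ x, θ₂ t x * (Torus.timeDeriv ψ t x +
          ⟪u t x, Torus.gradient (ψ t) x⟫_ℝ + κ * Torus.laplacian (ψ t) x) := by
      filter_upwards [hI₁.prod_right_ae, hI₂.prod_right_ae] with t ht₁ ht₂
      rw [← integral_const_mul, ← integral_sub ht₁ (ht₂.const_mul c)]
      refine integral_congr_ae (Eventually.of_forall fun x => ?_)
      dsimp only
      ring
    -- the source pairings cancel
    have hS : (∫ t in Ioo 0 T, ∫ x, s₁ t x * ψ t x) =
        c * ∫ t in Ioo 0 T, ∫ x, s₂ t x * ψ t x := by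
      rw [← integral_const_mul]
      refine integral_congr_ae (Eventually.of_forall fun t => ?_)
      dsimp only
      rw [← integral_const_mul]
      refine integral_congr_ae (Eventually.of_forall fun x => ?_)
      dsimp only
      rw [hs t x, mul_assoc]
    -- the datum pairing
    have hψ0 : Continuous (ψ 0) := (hψ.isSmooth_slice 0).continuous
    obtain ⟨K, hK⟩ := Torus.exists_forall_norm_le_of_continuous hψ0
    have hd₁ : Integrable (fun x => a₁ x * ψ 0 x) volume :=
      ha₁.mul_bdd hψ0.aestronglyMeasurable (Eventually.of_forall hK)
    have hd₂ : Integrable (fun x => a₂ x * ψ 0 x) volume :=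
      ha₂.mul_bdd hψ0.aestronglyMeasurable (Eventually.of_forall hK)
    have hD : ∫ x, (a₁ x - c * a₂ x) * ψ 0 x =
        (∫ x, a₁ x * ψ 0 x) - c * ∫ x, a₂ x * ψ 0 x := by
      rw [← integral_const_mul, ← integral_sub hd₁ (hd₂.const_mul c)]
      refine integral_congr_ae (Eventually.of_forall fun x => ?_)
      dsimp only
      ring
    rw [integral_congr_ae hslice, integral_sub hI₁.integral_prod_left
      (hI₂.integral_prod_left.const_mul c), integral_const_mul, hD]
    rw [hS] at e₁
    linear_combination e₁ - c * e₂

/-! ## The pointwise-in-time comparison -/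

/-- **Pointwise comparison.** For `a, b ∈ L²(T^d)` with `∫ b = 0`, `c : ℝ` and
`q := a - c b` with finite spectral gradient:
`c² ‖b‖₂² ≤ 2‖a‖₂² + ‖∇q‖₂² / (2π²)`. Indeed `∫ q = ∫ a =: m`, `c b = (a - m) - (q - m)`, so
`c² ∫ b² ≤ 2 Var a + 2 Var q ≤ 2‖a‖₂² + 2 · (4π²)⁻¹ ‖∇q‖₂²` by the spectral Poincaré inequality
(`Torus.scalarVariance_le_toReal_eScalarGradNormSq`). [folklore] -/
theorem sq_mul_scalarL2Sq_le {d : Type*} [Fintype d] {c : ℝ} {a b : UnitAddTorus d → ℝ}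
    (ha : MemLp a 2 volume) (hb : MemLp b 2 volume) (hb0 : ∫ x, b x = 0)
    (hfin : Torus.eScalarGradNormSq (fun x => a x - c * b x) ≠ ⊤) :
    c ^ 2 * Torus.scalarL2Sq b ≤ 2 * Torus.scalarL2Sq a +
      (2 * Real.pi ^ 2)⁻¹ * (Torus.eScalarGradNormSq (fun x => a x - c * b x)).toReal := by
  set q : UnitAddTorus d → ℝ := fun x => a x - c * b x with hq_def
  have hq : MemLp q 2 volume := ha.sub (hb.const_mul c)
  have hai : Integrable a volume := ha.integrable one_le_two
  have hbi : Integrable b volume := hb.integrable one_le_two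
  have hqi : Integrable q volume := hq.integrable one_le_two
  set m : ℝ := ∫ x, a x with hm_def
  have hqm : ∫ x, q x = m := by
    simp only [hq_def]
    rw [integral_sub hai (hbi.const_mul c), integral_const_mul, hb0, mul_zero, sub_zero]
  -- Poincaré for `q`
  have hP := Torus.scalarVariance_le_toReal_eScalarGradNormSq hq hfin
  rw [hqm] at hP
  -- pointwise: `c b = (a - m) - (q - m)`
  have hpt : ∀ x, (c * b x) ^ 2 ≤ 2 * (a x - m) ^ 2 + 2 * (q x - m) ^ 2 := fun x => by
    have e : c * b x = (a x - m) - (q x - m) := by simp only [hq_def]; ring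
    rw [e]
    nlinarith [sq_nonneg ((a x - m) + (q x - m))]
  have i1 : Integrable (fun x => (a x - m) ^ 2) volume := (ha.sub (memLp_const m)).integrable_sq
  have i2 : Integrable (fun x => (q x - m) ^ 2) volume := (hq.sub (memLp_const m)).integrable_sq
  have hle : ∫ x, (c * b x) ^ 2 ≤ ∫ x, (2 * (a x - m) ^ 2 + 2 * (q x - m) ^ 2) :=
    integral_mono_of_nonneg (Eventually.of_forall fun x => sq_nonneg _)
      ((i1.const_mul 2).add (i2.const_mul 2)) (Eventually.of_forall hpt)
  rw [integral_add (i1.const_mul 2) (i2.const_mul 2), integral_const_mul, integral_const_mul] at hle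
  -- the two variances
  have hva : ∫ x, (a x - m) ^ 2 = Torus.scalarL2Sq a - m ^ 2 := by
    have e3 : (fun x => (a x - m) ^ 2) = fun x => a x ^ 2 - (2 * m) * a x + m ^ 2 := by
      funext x; ring
    have j1 : Integrable (fun x => a x ^ 2) volume := ha.integrable_sq
    have j2 : Integrable (fun x => (2 * m) * a x) volume := hai.const_mul _
    have j3 : Integrable (fun _ : UnitAddTorus d => m ^ 2) volume := integrable_const _
    have j12 : Integrable (fun x => a x ^ 2 - (2 * m) * a x) volume := j1.sub j2
    rw [e3, integral_add j12 j3, integral_sub j1 j2, integral_const_mul, integral_const,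
      Torus.scalarL2Sq]
    simp only [probReal_univ, smul_eq_mul, one_mul]
    ring
  have hvq : ∫ x, (q x - m) ^ 2 = (∫ x, q x ^ 2) - m ^ 2 := by
    have e3 : (fun x => (q x - m) ^ 2) = fun x => q x ^ 2 - (2 * m) * q x + m ^ 2 := by
      funext x; ring
    have j1 : Integrable (fun x => q x ^ 2) volume := hq.integrable_sq
    have j2 : Integrable (fun x => (2 * m) * q x) volume := hqi.const_mul _
    have j3 : Integrable (fun _ : UnitAddTorus d => m ^ 2) volume := integrable_const _
    have j12 : Integrable (fun x => q x ^ 2 - (2 * m) * q x) volume := j1.sub j2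
    rw [e3, integral_add j12 j3, integral_sub j1 j2, integral_const_mul, integral_const, hqm]
    simp only [probReal_univ, smul_eq_mul, one_mul]
    ring
  have hcb : c ^ 2 * Torus.scalarL2Sq b = ∫ x, (c * b x) ^ 2 := by
    rw [Torus.scalarL2Sq, ← integral_const_mul]
    refine integral_congr_ae (Eventually.of_forall fun x => ?_)
    dsimp only
    ring
  have h4 : 0 < 4 * Real.pi ^ 2 := by positivity
  have hVq : (∫ x, q x ^ 2) - m ^ 2 ≤ (4 * Real.pi ^ 2)⁻¹ * (Torus.eScalarGradNormSq q).toReal := by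
    rw [← div_eq_inv_mul, le_div_iff₀' h4]
    exact hP
  have e2 : (2 * Real.pi ^ 2)⁻¹ * (Torus.eScalarGradNormSq q).toReal =
      2 * ((4 * Real.pi ^ 2)⁻¹ * (Torus.eScalarGradNormSq q).toReal) := by
    field_simp
    ring
  rw [hcb, e2]
  rw [hva, hvq] at hle
  nlinarith [sq_nonneg m]

/-! ## The per-horizon integrated enstrophy bound -/

/-- **Integrated comparison on one horizon.** For `ν > 0`, `c ≠ 0`, `T > 0`, a global weak
sourced scalar `θ` with source `c s` from `θ₀ ∈ L²`, a weak sourced scalar `ω` on `[0,T)` with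
source `s` (`∫ s = 0`) from a mean-zero `ω₀ ∈ L²`, over a drift `v` with `∫₀ᵀ ‖∇v‖₂ < ∞`, and
`‖ω t‖₂² = ‖∇v(t)‖₂²` a.e. on `(0,T)`:
`∫₀ᵀ ‖∇v‖₂² ≤ (2/c²) ∫₀ᵀ ‖θ‖₂² + ‖θ₀ - cω₀‖₂² / (4π²νc²)` — the free combination `q = θ - cω`
obeys the energy inequality `2ν∫₀ᵀ‖∇q‖² ≤ ‖q₀‖²` (DiPerna–Lions 1989, §II.3), and pointwise
`c²‖ω t‖² ≤ 2‖θ t‖² + ‖∇q t‖²/(2π²)` (`sq_mul_scalarL2Sq_le`). [folklore] -/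
theorem setIntegral_enstrophy_le {ν c T : ℝ}
    {v : ℝ → UnitAddTorus (Fin 2) → EuclideanSpace ℝ (Fin 2)} {s : UnitAddTorus (Fin 2) → ℝ}
    {θ₀ ω₀ : UnitAddTorus (Fin 2) → ℝ} {θ ω : ℝ → UnitAddTorus (Fin 2) → ℝ}
    (hν : 0 < ν) (hc : c ≠ 0) (hT : 0 < T)
    (hθ : Torus.IsWeakScalarTransportForced ν v (fun _ x => c * s x) θ₀ θ)
    (hθ₀ : MemLp θ₀ 2 volume) (hω₀ : MemLp ω₀ 2 volume) (hs0 : ∫ x, s x = 0)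
    (hω₀0 : ∫ x, ω₀ x = 0) (hω : Torus.IsWeakScalarTransportForcedOn T ν v (fun _ x => s x) ω₀ ω)
    (hae : ∀ᵐ t ∂(volume.restrict (Ioo 0 T)),
      MemLp (ω t) 2 volume ∧ ENNReal.ofReal (Torus.scalarL2Sq (ω t)) = Torus.eGradNormSq (v t))
    (hG : ∫⁻ t in Ioo 0 T, Torus.eGradNormSq (v t) ^ (1 / 2 : ℝ) < ⊤) :
    ∫ t in Ioc 0 T, (Torus.eGradNormSq (v t)).toReal ≤
      2 / c ^ 2 * (∫ t in Ioc 0 T, Torus.scalarL2Sq (θ t)) +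
        (∫⁻ x, ‖θ₀ x - c * ω₀ x‖ₑ ^ 2).toReal / (4 * Real.pi ^ 2 * ν * c ^ 2) := by
  have hθT := hθ T hT
  set q : ℝ → UnitAddTorus (Fin 2) → ℝ := fun t x => θ t x - c * ω t x with hq_def
  -- the free solution `q = θ - c ω`
  have hq : Torus.IsWeakScalarTransportOn T ν v (fun x => θ₀ x - c * ω₀ x) q :=
    isWeakScalarTransportOn_sub_mul hθT hω (fun _ _ => rfl) (hθ₀.integrable one_le_two)
      (hω₀.integrable one_le_two)
  -- the energy inequality over the `L¹ₜḢ¹ₓ` drift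
  have hE :=
    hq.energy_ineq_of_lintegral_eGradNormSq_rpow_lt_top hν (hθ₀.sub (hω₀.const_mul c)) hG
  set Q : ℝ≥0∞ := ∫⁻ x, ‖θ₀ x - c * ω₀ x‖ₑ ^ 2 with hQ_def
  have hQ : Q < ⊤ := by
    have e : Q = eLpNorm (fun x => θ₀ x - c * ω₀ x) 2 volume ^ 2 := by
      rw [PassiveScalarProofs.eLpNorm_two_pow_two]
    rw [e]
    exact ENNReal.pow_lt_top (hθ₀.sub (hω₀.const_mul c)).eLpNorm_lt_top
  set X : ℝ≥0∞ := ∫⁻ t in Ioo 0 T, Torus.eScalarGradNormSq (q t) with hX_def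
  have hE' : 2 * (ENNReal.ofReal ν * X) ≤ Q := hE
  have hX : X < ⊤ := by
    have h1 : ENNReal.ofReal ν * X < ⊤ := by
      refine lt_of_le_of_lt ?_ hQ
      calc ENNReal.ofReal ν * X ≤ 2 * (ENNReal.ofReal ν * X) := le_mul_of_one_le_left' one_le_two
        _ ≤ Q := hE'
    rcases ENNReal.mul_lt_top_iff.1 h1 with ⟨-, h⟩ | h0 | h0
    · exact h
    · exact absurd h0 (ENNReal.ofReal_pos.2 hν).ne'
    · rw [h0]; exact ENNReal.zero_lt_top
  have hXle : 2 * (ν * X.toReal) ≤ Q.toReal := by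
    have h := ENNReal.toReal_mono hQ.ne hE'
    rwa [ENNReal.toReal_mul, ENNReal.toReal_mul, ENNReal.toReal_ofReal hν.le,
      ENNReal.toReal_ofNat] at h
  -- integrability in time
  have hm : AEMeasurable (fun t => Torus.eScalarGradNormSq (q t)) (volume.restrict (Ioo 0 T)) :=
    hq.aemeasurable_eScalarGradNormSq
  have hDi :
      Integrable (fun t => (Torus.eScalarGradNormSq (q t)).toReal) (volume.restrict (Ioo 0 T)) :=
    integrable_toReal_of_lintegral_ne_top hm hX.ne
  have hDint : ∫ t in Ioo 0 T, (Torus.eScalarGradNormSq (q t)).toReal = X.toReal :=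
    integral_toReal hm (ae_lt_top' hm hX.ne)
  have hSi : IntegrableOn (fun t => Torus.scalarL2Sq (θ t)) (Ioo 0 T) volume :=
    (integrableOn_Ioc_iff_integrableOn_Ioo (f := fun t => Torus.scalarL2Sq (θ t))).1
      (Torus.integrableOn_scalarL2Sq hθ hT).1
  -- mean conservation for `ω`
  have hω0 : ∀ᵐ t ∂(volume.restrict (Ioo 0 T)), ∫ x, ω t x = 0 := by
    filter_upwards [hω.ae_integral_eq] with t ht
    rw [ht, hω₀0, zero_add]
    simp only [hs0, integral_zero]
  -- the pointwise a.e. bound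
  have hpt : ∀ᵐ t ∂(volume.restrict (Ioo 0 T)), (Torus.eGradNormSq (v t)).toReal ≤
      2 / c ^ 2 * Torus.scalarL2Sq (θ t) +
        (2 * Real.pi ^ 2 * c ^ 2)⁻¹ * (Torus.eScalarGradNormSq (q t)).toReal := by
    filter_upwards [hae, hθT.ae_memLp_two, hω0, ae_lt_top' hm hX.ne] with t ht hmθ hω0t htop
    obtain ⟨hmω, hZ⟩ := ht
    have hZ' : (Torus.eGradNormSq (v t)).toReal = Torus.scalarL2Sq (ω t) := by
      rw [← hZ, ENNReal.toReal_ofReal (Torus.scalarL2Sq_nonneg _)]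
    have h1 := sq_mul_scalarL2Sq_le (c := c) hmθ hmω hω0t htop.ne
    have hc2 : 0 < c ^ 2 := by positivity
    have h2 : Torus.scalarL2Sq (ω t) ≤ (c ^ 2)⁻¹ * (2 * Torus.scalarL2Sq (θ t) +
        (2 * Real.pi ^ 2)⁻¹ * (Torus.eScalarGradNormSq (q t)).toReal) := by
      rw [le_inv_mul_iff₀ hc2]
      exact h1
    rw [hZ']
    refine h2.trans_eq ?_
    simp only [hq_def]
    field_simp
  -- integrate over `(0, T)`
  have hint : ∫ t in Ioo 0 T, (Torus.eGradNormSq (v t)).toReal ≤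
      ∫ t in Ioo 0 T, (2 / c ^ 2 * Torus.scalarL2Sq (θ t) +
        (2 * Real.pi ^ 2 * c ^ 2)⁻¹ * (Torus.eScalarGradNormSq (q t)).toReal) :=
    integral_mono_of_nonneg (Eventually.of_forall fun _ => ENNReal.toReal_nonneg)
      ((hSi.const_mul _).add (hDi.const_mul _)) hpt
  rw [integral_add (hSi.const_mul _) (hDi.const_mul _), integral_const_mul, integral_const_mul,
    hDint] at hint
  rw [integral_Ioc_eq_integral_Ioo, integral_Ioc_eq_integral_Ioo]
  have hfinal :
      (2 * Real.pi ^ 2 * c ^ 2)⁻¹ * X.toReal ≤ Q.toReal / (4 * Real.pi ^ 2 * ν * c ^ 2) := by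
    have h3 : X.toReal ≤ Q.toReal / (2 * ν) := by
      rw [le_div_iff₀ (by positivity)]
      linarith
    calc (2 * Real.pi ^ 2 * c ^ 2)⁻¹ * X.toReal
        ≤ (2 * Real.pi ^ 2 * c ^ 2)⁻¹ * (Q.toReal / (2 * ν)) :=
          mul_le_mul_of_nonneg_left h3 (by positivity)
      _ = Q.toReal / (4 * Real.pi ^ 2 * ν * c ^ 2) := by
          field_simp
          ring
  linarith

/-! ## The registered stub -/

/-- **S6-co/B `stub_coscalarEnstrophyBound` — bounded variance of the co-scalar forces bounded
enstrophy.** For `ν > 0`, `c ≠ 0`, smooth steady `g`, a global Leray–Hopf `v`, a weak sourced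
scalar `θ` with source `c·curl g` from `θ₀ ∈ L²`, a mean-zero `ω₀ ∈ L²` and, on every `[0,T)`, a
weak sourced scalar `ω` with source `curl g`, datum `ω₀`, over the same drift, with
`‖ω t‖₂² = eGradNormSq (v t)` a.e.: `⟨‖∇v‖₂²⟩ ≤ (2/c²)⟨‖θ‖₂²⟩` (honest `limsup` means). Proof:
`setIntegral_enstrophy_le` on every horizon (the drift is `L¹ₜḢ¹ₓ` by
`QuietOfSubLog.lintegral_rpow_half_eGradNormSq_lt_top`), then
`longTimeAvgSup_le_mul_of_setIntegral_le` with the honest bound on the running means of `‖θ‖₂²`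
(`Torus.isBoundedUnder_timeMean_scalarL2Sq`; the source `c·curl g` is smooth with zero mean).
[folklore] -/
theorem stub_coscalarEnstrophyBound :
    ∀ (ν c : ℝ) (g : UnitAddTorus (Fin 2) → EuclideanSpace ℝ (Fin 2)),
      0 < ν → c ≠ 0 → Torus.IsSmooth g → Torus.IsDivFree g → Torus.HasZeroMean g →
      ∀ (v₀ : UnitAddTorus (Fin 2) → EuclideanSpace ℝ (Fin 2))
        (v : ℝ → UnitAddTorus (Fin 2) → EuclideanSpace ℝ (Fin 2))
        (θ₀ : UnitAddTorus (Fin 2) → ℝ) (θ : ℝ → UnitAddTorus (Fin 2) → ℝ)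
        (ω₀ : UnitAddTorus (Fin 2) → ℝ),
        Torus.IsGlobalLerayHopf ν (fun _ => g) v₀ v →
        MemLp θ₀ 2 volume →
        Torus.IsWeakScalarTransportForced ν v
          (fun _ x => c * (Torus.partialDeriv 0 g x 1 - Torus.partialDeriv 1 g x 0)) θ₀ θ →
        MemLp ω₀ 2 volume → (∫ x, ω₀ x = 0) →
        (∀ T : ℝ, 0 < T → ∃ ω : ℝ → UnitAddTorus (Fin 2) → ℝ,
            Torus.IsWeakScalarTransportForcedOn T ν v
              (fun _ x => Torus.partialDeriv 0 g x 1 - Torus.partialDeriv 1 g x 0) ω₀ ω ∧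
            ∀ᵐ t ∂(volume.restrict (Set.Ioo 0 T)),
              MemLp (ω t) 2 volume ∧ ENNReal.ofReal (Torus.scalarL2Sq (ω t)) = Torus.eGradNormSq (v t)) →
        longTimeAvgSup (fun t => (Torus.eGradNormSq (v t)).toReal) ≤
          2 / c ^ 2 * longTimeAvgSup (fun t => Torus.scalarL2Sq (θ t)) := by
  intro ν c g hν hc hgs _ _ v₀ v θ₀ θ ω₀ hLH hθ₀ hθ hω₀ hω₀0 hω
  -- the source profile `curl g` is smooth with zero mean
  have hss : Torus.IsSmooth (fun x => Torus.partialDeriv 0 g x 1 - Torus.partialDeriv 1 g x 0) :=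
    ((hgs.partialDeriv 0).apply 1).sub ((hgs.partialDeriv 1).apply 0)
  have hs0 : ∫ x, (Torus.partialDeriv 0 g x 1 - Torus.partialDeriv 1 g x 0) = 0 := by
    have i0 : Integrable (fun x => Torus.partialDeriv 0 g x 1) volume :=
      ((hgs.partialDeriv 0).apply 1).integrable
    have i1 : Integrable (fun x => Torus.partialDeriv 1 g x 0) volume :=
      ((hgs.partialDeriv 1).apply 0).integrable
    have e0 : ∫ x, Torus.partialDeriv 0 g x 1 = 0 := by
      have hc0 :=
        (EuclideanSpace.proj (1 : Fin 2) : EuclideanSpace ℝ (Fin 2) →L[ℝ] ℝ).integral_comp_comm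
          (hgs.partialDeriv 0).integrable
      rw [show (∫ x, Torus.partialDeriv 0 g x 1) = ∫ x,
          (EuclideanSpace.proj (1 : Fin 2) : EuclideanSpace ℝ (Fin 2) →L[ℝ] ℝ) (Torus.partialDeriv 0 g x)
          from rfl, hc0, Torus.integral_partialDeriv_eq_zero_holds hgs 0]
      rfl
    have e1 : ∫ x, Torus.partialDeriv 1 g x 0 = 0 := by
      have hc1 :=
        (EuclideanSpace.proj (0 : Fin 2) : EuclideanSpace ℝ (Fin 2) →L[ℝ] ℝ).integral_comp_comm
          (hgs.partialDeriv 1).integrable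
      rw [show (∫ x, Torus.partialDeriv 1 g x 0) = ∫ x,
          (EuclideanSpace.proj (0 : Fin 2) : EuclideanSpace ℝ (Fin 2) →L[ℝ] ℝ) (Torus.partialDeriv 1 g x)
          from rfl, hc1, Torus.integral_partialDeriv_eq_zero_holds hgs 1]
      rfl
    rw [integral_sub i0 i1, e0, e1, sub_zero]
  have hhs :
      Torus.IsSmooth (fun x => c * (Torus.partialDeriv 0 g x 1 - Torus.partialDeriv 1 g x 0)) :=
    hss.smul c
  have hhz : Torus.HasZeroMean
      (fun x => c * (Torus.partialDeriv 0 g x 1 - Torus.partialDeriv 1 g x 0)) := by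
    show ∫ x, c * (Torus.partialDeriv 0 g x 1 - Torus.partialDeriv 1 g x 0) = 0
    rw [integral_const_mul, hs0, mul_zero]
  -- the Leray–Hopf drift is `L¹ₜḢ¹ₓ` on every horizon
  have hG : ∀ T, 0 < T → ∫⁻ t in Ioo 0 T, Torus.eGradNormSq (v t) ^ (1 / 2 : ℝ) < ⊤ :=
    fun T hT => QuietOfSubLog.lintegral_rpow_half_eGradNormSq_lt_top hLH hT
  -- honest running means of `‖θ‖₂²`
  have hEb := Torus.isBoundedUnder_timeMean_scalarL2Sq hν hθ hθ₀ hhs hhz hG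
  refine Literature.Barriers.AnomalousDissipation.longTimeAvgSup_le_mul_of_setIntegral_le
    (C := (∫⁻ x, ‖θ₀ x - c * ω₀ x‖ₑ ^ 2).toReal / (4 * Real.pi ^ 2 * ν * c ^ 2))
    (by positivity) (fun _ => ENNReal.toReal_nonneg) (fun _ => Torus.scalarL2Sq_nonneg _) hEb
    fun T hT => ?_
  obtain ⟨ω, hωT, hae⟩ := hω T hT
  exact setIntegral_enstrophy_le hν hc hT hθ hθ₀ hω₀ hs0 hω₀0 hωT hae (hG T hT)

end Summit.AnomalousDissipation.AnomalousDissipation.Theorems.TwohalfdNeg.CoscalarEnstrophyBound
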